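import Summits.QuantumFields.YangMills.Theorems.FlatTubeReductionExactDressingOfCoreProfile
import Summits.QuantumFields.YangMills.Theorems.FlatTubeReductionExactDressingOfProfileNumbersSq
import HarnessLib

/-!
# THE EXACT DRESSING IS UNCONDITIONAL FOR CORE-SUPPORTED PROFILES — FP RADIUS `β⁻¹`: `exactDressing_of_coreProfile` of `…ExactDressingOfCoreProfile` with the Faddeev–Popov weight
# `fpWeight β⁻¹` (lane A's weight of record; forced by the off-diagonal rate analysis, `…DressedFixedBeta`) in place of `fpWeight (√β)⁻¹`
# (route `FlatTubeReduction`, crux K1 `NearFlatRatioLaw` stmt-QuantumFields-24720; seat `ym-line-ftr-p1` g15; rate twin «ratepack-v3 / frozen fibres»; R2b1 RECORD rung — no summit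
# statement is proved here)

WHY (PICKED.md g15; NOTES T5).  Same seven scalar profile numbers (`A = 16`, tails `≡ 0`) fed to `exactDressing_of_profileNumbers_sq`; the profile support radius stays `(√β)⁻¹`, only the
colour-localisation radius of the kernel changes.
  ★★★★ `exactDressing_of_coreProfile_sq`.
HONEST FRAMING: corollary; femto rung R2b1 (RECORD label); not infinite volume, not a gap, not Clay.  No defs, no named facts, no `sorry`.
-/

set_option autoImplicit false

noncomputable section

open MeasureTheory Filter Topology Real Set
open scoped BigOperators
open Literature.MathematicalPhysics.QuantumFieldTheory
open Literature.MathematicalPhysics.QuantumLattice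

namespace Summit.QuantumFields.YangMills.Theorems.FemtoTransferGap.RateTube

open Summit.QuantumFields.YangMills.Theorems.FemtoTransferGap
open Summit.QuantumFields.YangMills.Theorems.FemtoTransferGap.TwoLattice
open Summit.QuantumFields.YangMills.Theorems.FemtoTransferGap.TwoLattice.ConstTube
open Summit.QuantumFields.YangMills.Theorems.FemtoTransferGap.TwoLattice.Avg
open Summit.QuantumFields.YangMills.Theorems.FemtoTransferGap.TwoLattice.Cov
open Summit.QuantumFields.YangMills.Theorems.FemtoTransferGap.TwoLattice.Stiff (LinkSpace)
open Summit.QuantumFields.YangMills.Theorems.FemtoCutoffLadder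

variable {L : ℕ} [NeZero L]

/-- ★★★★ **THE EXACT DRESSING FOR CORE-SUPPORTED PROFILES, UNCONDITIONALLY.**  Window `δ₁ = D_w·recordDelta1 L (1/6)` (`D_w ≥ 0`); a profile family `Ω β` (measurable,
`0 ≤ Ω β ≤ CΩ β`, colour-blind) supported in the fibre core `{cap, ‖v̂‖ ≤ (√β)⁻¹, |v_{e,c}| ≤ (√β)⁻¹}` for every `β`, with `∫Ω β dπ > 0` eventually.  THEN with the FP window
`ε = (√β)⁻¹` the conclusion of `exactDressing_fields` holds: `∃ κ ≥ 0, ε_W = O(λ_b²)` such that `W̃ β = clampW κ (f_β/f_β(1)) (min(d_tor,½))` is physical, `0 ≤ W̃ ≤ √(1+κ/4)`,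
`|W̃ β u² − 1| ≤ κ·orbitDist u²` on the window for every `β`, and `|W̃ β u² − f̂_β u| ≤ ε_W β` on the window eventually. [cite: Luscher1983, §3] -/
theorem exactDressing_of_coreProfile_sq {Dw : ℝ} (hDw : 0 ≤ Dw) (Ω : ℝ → LinkSpace L → ℝ) (CΩ : ℝ → ℝ)
    (hΩm : ∀ β, Measurable (Ω β)) (hCΩ : ∀ β x, |Ω β x| ≤ CΩ β) (hΩ0 : ∀ β x, 0 ≤ Ω β x) (hΩinv : ∀ β (g : SU2) (x : LinkSpace L), Ω β (adL L g x) = Ω β x)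
    (hΩs : ∀ β (v : Edge 3 L → Fin 3 → ℝ), Ω β (linkEmbed L v) ≠ 0 →
      v ∈ capBalancedSet L ∧ ‖linkEmbed L v‖ ≤ (Real.sqrt β)⁻¹ ∧ ∀ (e : Edge 3 L) (c : Fin 3), |v e c| ≤ (Real.sqrt β)⁻¹)
    (hθ : ∀ᶠ β : ℝ in atTop, 0 < ∫ v, Ω β (linkEmbed L v) ∂orthoTransverse L) :
    ∃ κ : ℝ, 0 ≤ κ ∧ ∃ εW : ℝ → ℝ, (∃ a' : ℝ, ∀ᶠ β : ℝ in atTop, εW β ≤ a' * bareLambda ((L : ℝ) ^ 3 * β) ^ 2) ∧ (∀ᶠ β : ℝ in atTop, 0 ≤ εW β) ∧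
      (∀ β, IsPhys (clampW κ (fun u : GaugeConfig 3 1 SU2 => fpBOKernel L β (Ω β) (fpWeight L β⁻¹) u u / transferKernel su2Rep ((L : ℝ) ^ 3 * β) u u /
          (fpBOKernel L β (Ω β) (fpWeight L β⁻¹) 1 1 / transferKernel su2Rep ((L : ℝ) ^ 3 * β) (1 : GaugeConfig 3 1 SU2) 1))
        (fun U : GaugeConfig 3 1 SU2 => min (torDist U) (1 / 2)))) ∧
      (∀ β u, 0 ≤ clampW κ (fun u : GaugeConfig 3 1 SU2 => fpBOKernel L β (Ω β) (fpWeight L β⁻¹) u u / transferKernel su2Rep ((L : ℝ) ^ 3 * β) u u /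
          (fpBOKernel L β (Ω β) (fpWeight L β⁻¹) 1 1 / transferKernel su2Rep ((L : ℝ) ^ 3 * β) (1 : GaugeConfig 3 1 SU2) 1))
        (fun U : GaugeConfig 3 1 SU2 => min (torDist U) (1 / 2)) u) ∧
      (∀ β u, |clampW κ (fun u : GaugeConfig 3 1 SU2 => fpBOKernel L β (Ω β) (fpWeight L β⁻¹) u u / transferKernel su2Rep ((L : ℝ) ^ 3 * β) u u /
          (fpBOKernel L β (Ω β) (fpWeight L β⁻¹) 1 1 / transferKernel su2Rep ((L : ℝ) ^ 3 * β) (1 : GaugeConfig 3 1 SU2) 1))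
        (fun U : GaugeConfig 3 1 SU2 => min (torDist U) (1 / 2)) u| ≤ Real.sqrt (1 + κ / 4)) ∧
      (∀ β u, orbitDist u < Dw * recordDelta1 L (1 / 6) β →
        |clampW κ (fun u : GaugeConfig 3 1 SU2 => fpBOKernel L β (Ω β) (fpWeight L β⁻¹) u u / transferKernel su2Rep ((L : ℝ) ^ 3 * β) u u /
          (fpBOKernel L β (Ω β) (fpWeight L β⁻¹) 1 1 / transferKernel su2Rep ((L : ℝ) ^ 3 * β) (1 : GaugeConfig 3 1 SU2) 1))
        (fun U : GaugeConfig 3 1 SU2 => min (torDist U) (1 / 2)) u ^ 2 - 1| ≤ κ * orbitDist u ^ 2) ∧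
      (∀ᶠ β : ℝ in atTop, ∀ u : GaugeConfig 3 1 SU2, orbitDist u < Dw * recordDelta1 L (1 / 6) β →
        |clampW κ (fun u : GaugeConfig 3 1 SU2 => fpBOKernel L β (Ω β) (fpWeight L β⁻¹) u u / transferKernel su2Rep ((L : ℝ) ^ 3 * β) u u /
          (fpBOKernel L β (Ω β) (fpWeight L β⁻¹) 1 1 / transferKernel su2Rep ((L : ℝ) ^ 3 * β) (1 : GaugeConfig 3 1 SU2) 1))
        (fun U : GaugeConfig 3 1 SU2 => min (torDist U) (1 / 2)) u ^ 2 -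
          fpBOKernel L β (Ω β) (fpWeight L β⁻¹) u u / transferKernel su2Rep ((L : ℝ) ^ 3 * β) u u /
            (fpBOKernel L β (Ω β) (fpWeight L β⁻¹) 1 1 / transferKernel su2Rep ((L : ℝ) ^ 3 * β) (1 : GaugeConfig 3 1 SU2) 1)| ≤ εW β) := by
  haveI := isFiniteMeasure_orthoTransverse L
  have hle := measurable_linkEmbed L
  -- the fibre cores and the mass
  set C : ℝ → Set (Edge 3 L → Fin 3 → ℝ) := fun β => {v | v ∈ capBalancedSet L ∧ ‖linkEmbed L v‖ ≤ (Real.sqrt β)⁻¹ ∧ ∀ (e : Edge 3 L) (c : Fin 3), |v e c| ≤ (Real.sqrt β)⁻¹} with hCdef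
  have hC : ∀ β, MeasurableSet (C β) := fun β => measurableSet_fibreCore (L := L) (Real.sqrt β)⁻¹
  have hCsub : ∀ β, ∀ v ∈ C β, v ∈ capBalancedSet L ∧ ‖linkEmbed L v‖ ≤ (Real.sqrt β)⁻¹ ∧ ∀ (e : Edge 3 L) (c : Fin 3), |v e c| ≤ (Real.sqrt β)⁻¹ := fun β v hv => hv
  have hθC : ∀ β, ∫ v in C β, Ω β (linkEmbed L v) ∂orthoTransverse L = ∫ v, Ω β (linkEmbed L v) ∂orthoTransverse L := fun β =>
    setIntegral_eq_integral_of_forall_compl_eq_zero fun v hv => by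
      by_contra h; exact hv (hΩs β v h)
  -- integrability of the profile numbers' integrands
  have hint : ∀ β (g : (Edge 3 L → Fin 3 → ℝ) → ℝ), Measurable g → (∀ v, 0 ≤ g v) → (∀ v, Ω β (linkEmbed L v) ≠ 0 → g v ≤ 16) →
      ∫ v, Ω β (linkEmbed L v) * g v ∂orthoTransverse L ≤ 16 * ∫ v in C β, Ω β (linkEmbed L v) ∂orthoTransverse L := by
    intro β g hgm hg0 hg
    rw [hθC β, ← integral_const_mul]
    have hpt : ∀ v, Ω β (linkEmbed L v) * g v ≤ 16 * Ω β (linkEmbed L v) := fun v => by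
      by_cases h : Ω β (linkEmbed L v) = 0
      · rw [h]; simp
      · nlinarith [hg v h, hΩ0 β (linkEmbed L v), hg0 v]
    have hCΩ0 : 0 ≤ CΩ β := (abs_nonneg _).trans (hCΩ β 0)
    refine integral_mono_of_nonneg (ae_of_all _ fun v => mul_nonneg (hΩ0 β _) (hg0 v)) ?_ (ae_of_all _ hpt)
    exact (integrable_of_measurable_abs_le (orthoTransverse L) (hΩm β |>.comp hle) (fun v => hCΩ β _)).const_mul 16
  -- pointwise facts on the support
  have hsupp : ∀ β v, Ω β (linkEmbed L v) ≠ 0 → 0 < β → Real.sqrt β * ‖linkEmbed L v‖ ≤ 1 ∧ β * ‖linkEmbed L v‖ ^ 2 ≤ 1 := by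
    intro β v hv hβ0
    obtain ⟨-, hr, -⟩ := hΩs β v hv
    have hs0 : 0 < Real.sqrt β := Real.sqrt_pos.mpr hβ0
    have h1 : Real.sqrt β * ‖linkEmbed L v‖ ≤ 1 := by
      calc Real.sqrt β * ‖linkEmbed L v‖ ≤ Real.sqrt β * (Real.sqrt β)⁻¹ := mul_le_mul_of_nonneg_left hr hs0.le
        _ = 1 := mul_inv_cancel₀ hs0.ne'
    refine ⟨h1, ?_⟩
    have h2 : β * ‖linkEmbed L v‖ ^ 2 = (Real.sqrt β * ‖linkEmbed L v‖) ^ 2 := by rw [mul_pow, Real.sq_sqrt hβ0.le]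
    rw [h2]; nlinarith [mul_nonneg hs0.le (norm_nonneg (linkEmbed L v))]
  -- the seven scalar facts
  have hθ' : ∀ᶠ β : ℝ in atTop, 0 < ∫ v in C β, Ω β (linkEmbed L v) ∂orthoTransverse L := by filter_upwards [hθ] with β h; rwa [hθC β]
  have hθ0 : ∀ β, 0 ≤ ∫ v in C β, Ω β (linkEmbed L v) ∂orthoTransverse L := fun β => by rw [hθC β]; exact integral_nonneg fun v => hΩ0 β _
  have hI : ∀ᶠ β : ℝ in atTop, ∫ v, Ω β (linkEmbed L v) ∂orthoTransverse L ≤ 16 * ∫ v in C β, Ω β (linkEmbed L v) ∂orthoTransverse L :=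
    Filter.Eventually.of_forall fun β => by rw [← hθC β]; linarith [hθ0 β]
  have hM : ∀ᶠ β : ℝ in atTop, ∫ v, Ω β (linkEmbed L v) * (Real.sqrt β * ‖linkEmbed L v‖) ^ (3 * Fintype.card {x : Site 3 L // ¬x = 0}) ∂orthoTransverse L ≤
      16 * ∫ v in C β, Ω β (linkEmbed L v) ∂orthoTransverse L := by
    filter_upwards [Filter.eventually_gt_atTop (0 : ℝ)] with β hβ0
    refine hint β _ ((measurable_const.mul hle.norm).pow_const _) (fun v => by positivity) fun v hv => ?_
    exact (pow_le_one₀ (by positivity) (hsupp β v hv hβ0).1).trans (by norm_num)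
  have hI4 : ∀ᶠ β : ℝ in atTop, ∫ v, Ω β (linkEmbed L v) * (1 + β * ‖linkEmbed L v‖ ^ 2) ^ 4 ∂orthoTransverse L ≤ 16 * ∫ v in C β, Ω β (linkEmbed L v) ∂orthoTransverse L := by
    filter_upwards [Filter.eventually_gt_atTop (0 : ℝ)] with β hβ0
    refine hint β _ ((measurable_const.add ((hle.norm.pow_const 2).const_mul β)).pow_const 4) (fun v => by positivity) fun v hv => ?_
    have := (hsupp β v hv hβ0).2
    calc (1 + β * ‖linkEmbed L v‖ ^ 2) ^ 4 ≤ (1 + 1) ^ 4 := pow_le_pow_left₀ (by positivity) (by linarith) 4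
      _ = 16 := by norm_num
  have hM4 : ∀ᶠ β : ℝ in atTop, ∫ v, Ω β (linkEmbed L v) * (1 + β * ‖linkEmbed L v‖ ^ 2) ^ 4 * (Real.sqrt β * ‖linkEmbed L v‖) ^ (3 * Fintype.card {x : Site 3 L // ¬x = 0}) ∂orthoTransverse L ≤
      16 * ∫ v in C β, Ω β (linkEmbed L v) ∂orthoTransverse L := by
    filter_upwards [Filter.eventually_gt_atTop (0 : ℝ)] with β hβ0
    have h := hint β (fun v => (1 + β * ‖linkEmbed L v‖ ^ 2) ^ 4 * (Real.sqrt β * ‖linkEmbed L v‖) ^ (3 * Fintype.card {x : Site 3 L // ¬x = 0}))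
      (((measurable_const.add ((hle.norm.pow_const 2).const_mul β)).pow_const 4).mul ((measurable_const.mul hle.norm).pow_const _)) (fun v => by positivity) fun v hv => by
        obtain ⟨h1, h2⟩ := hsupp β v hv hβ0
        have ha : (1 + β * ‖linkEmbed L v‖ ^ 2) ^ 4 ≤ 16 := by
          calc (1 + β * ‖linkEmbed L v‖ ^ 2) ^ 4 ≤ (1 + 1) ^ 4 := pow_le_pow_left₀ (by positivity) (by linarith) 4
            _ = 16 := by norm_num
        have hb : (Real.sqrt β * ‖linkEmbed L v‖) ^ (3 * Fintype.card {x : Site 3 L // ¬x = 0}) ≤ 1 := pow_le_one₀ (by positivity) h1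
        calc (1 + β * ‖linkEmbed L v‖ ^ 2) ^ 4 * (Real.sqrt β * ‖linkEmbed L v‖) ^ (3 * Fintype.card {x : Site 3 L // ¬x = 0}) ≤ 16 * 1 :=
              mul_le_mul ha hb (by positivity) (by norm_num)
          _ = 16 := by norm_num
    refine le_trans (le_of_eq ?_) h
    refine integral_congr_ae (ae_of_all _ fun v => ?_)
    simp only [mul_assoc]
  have htail : ∀ β, 1 ≤ β → ∀ (g : (Edge 3 L → Fin 3 → ℝ) → ℝ),
      ∫ v in {v | β ^ ((1 : ℝ) / 8) < β * ‖linkEmbed L v‖ ^ 2}, Ω β (linkEmbed L v) * g v ∂orthoTransverse L = 0 := by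
    intro β hβ1 g
    refine setIntegral_eq_zero_of_forall_eq_zero fun v hv => ?_
    simp only [Set.mem_setOf_eq] at hv
    by_cases h : Ω β (linkEmbed L v) = 0
    · rw [h, zero_mul]
    · exfalso
      have h2 := (hsupp β v h (by linarith)).2
      have hT1 : 1 ≤ β ^ ((1 : ℝ) / 8) := Real.one_le_rpow hβ1 (by norm_num)
      linarith
  have htail0 : ∀ᶠ β : ℝ in atTop, ∫ v in {v | β ^ ((1 : ℝ) / 8) < β * ‖linkEmbed L v‖ ^ 2}, Ω β (linkEmbed L v) ∂orthoTransverse L ≤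
      (fun _ : ℝ => (0 : ℝ)) β * ∫ v in C β, Ω β (linkEmbed L v) ∂orthoTransverse L := by
    filter_upwards [Filter.eventually_ge_atTop (1 : ℝ)] with β hβ1
    have h := htail β hβ1 (fun _ => 1)
    simp only [mul_one] at h
    rw [h]; simp
  have htail3 : ∀ᶠ β : ℝ in atTop, ∫ v in {v | β ^ ((1 : ℝ) / 8) < β * ‖linkEmbed L v‖ ^ 2}, Ω β (linkEmbed L v) * (Real.sqrt β * ‖linkEmbed L v‖) ^ (3 * Fintype.card {x : Site 3 L // ¬x = 0}) ∂orthoTransverse L ≤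
      (fun _ : ℝ => (0 : ℝ)) β * ∫ v in C β, Ω β (linkEmbed L v) ∂orthoTransverse L := by
    filter_upwards [Filter.eventually_ge_atTop (1 : ℝ)] with β hβ1
    rw [htail β hβ1]; simp
  have hRτ : ∀ᶠ β : ℝ in atTop, (fun β : ℝ => (Real.sqrt β)⁻¹) β ≤ 1 / 30 := by
    filter_upwards [Filter.eventually_ge_atTop (900 : ℝ)] with β hβ; exact (inv_sqrt_window hβ).2.1
  exact exactDressing_of_profileNumbers_sq (L := L) (A := 16) (At := 0) (ct := 1) hDw (by norm_num) le_rfl one_pos Ω CΩ (fun β => (Real.sqrt β)⁻¹) (fun β => (Real.sqrt β)⁻¹)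
    (fun _ => 0) C hΩm hCΩ hΩ0 hΩinv (fun β v hv => ⟨(hΩs β v hv).1, (hΩs β v hv).2.1⟩) hRτ (fun β v hv => (hΩs β v hv).2.2) (window_compatible_invSqrt (L := L) hDw) hC hCsub hθ' hI hM
    hI4 hM4 (Filter.Eventually.of_forall fun _ => le_rfl) htail0 htail3 (Filter.Eventually.of_forall fun β => by positivity)

end Summit.QuantumFields.YangMills.Theorems.FemtoTransferGap.RateTube

end
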